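import Summits.BirchSwinnertonDyer.BirchSwinnertonDyer.Theorems.ManinLocalTwoThreeIstarDeepAtTwoLoop
import Literature.NumberTheory.DiophantineGeometry.ConductorExponentLeTwoOfTwoTorsionProofs
import HarnessLib

/-!
# On the `f₂ = 4` rows `Iₙ*/(n+8)`, `n ≥ 4`, `a₁/2` is a unit, `ord c₄ = 4` and `|j|₂ = 2^{n−4} ≥ 1`
# (route `ManinLocalTwoThree`, crux C2 `ManinOddAtFour` stmt-BirchSwinnertonDyer-22967; an g32 §11 S-an-63 «16 ∥ N descends», rows `I₄*/12`,
# `Iₙ≥5*/(n+8)`; cell bsd-f2-manin, p2 gen 14)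

Sequel of `ManinLocalTwoThreeIstarDeepAtTwoLoop` (`Iₙ*`, `n ≥ 2`, with `4 ∣ a₁` on a step-6-normalised model has `ord Δ ≥ n + 9`).
§1 (over a DVR in which `2` is a uniformiser): on the tree's Step-7 form `[2α, 2β, 4γ, 8q, 16r]` of a curve of type `Iₙ*` with
`ord Δ = n + 8`, `n ≥ 2`, `α` is a unit and `c₄ = 16·(α⁴ + 2(2α²β + 2β² − 12q − 6αγ))` has `ord c₄ = 4`.  §2 (Dedekind domain, absolutely
unramified `2`-adic place): `|j|_v = exp(n − 4)` for `Iₙ*/(n+8)`, read on `N ⊗ K_v ≅ W ⊗ K_v`; for the `f = 4` rows of p3's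
`kodairaSymbolAt_of_conductorExponent_eq_four_two` (`I₄*/12`, `I*_{m+5}/(m+13)`) this is `|j|_v ≥ 1`, i.e. `ord_v j ≤ 0` — the input of
this seat's `conductorExponent_quadraticTwist_le_one_of_one_le_valuation_j_of_eq_four` (`ManinLocalTwoThreeSixteenDescendsOrdJ`): these rows
twist by `d ≡ 3 (mod 4)` to SEMISTABLE curves (Barrios et al. 2025, Table localdata-dodd, rows `I₄* → I₀`, `Iₙ≥5* → I_{n−4}`).
HONEST FRAMING: local bookkeeping in print, kernel-checked; nothing about BSD or Manin's conjecture is proved; C2 OPEN.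
[cite: SilvermanATAEC1994, IV.9.4 Step 7 (PDF pp. 345–346) and Table 4.1] [cite: Papadopoulos1993, Table IV (p = 2)]
[cite: BarriosEtAl2025, Thm. 5.1, Table localdata-dodd, rows I*ₙ (arXiv:2501.03209 p. 16)]
-/

set_option autoImplicit false
-- lint-debt: the directory name repeats the summit name (sibling precedent `ManinLocalTwoThreeConductorExponentThreeAtTwo.lean`)
set_option linter.dupNamespace false

noncomputable section

open Polynomial IsLocalRing
open IsDiscreteValuationRing hiding maximalIdeal
open Literature.NumberTheory.DiophantineGeometry Literature.NumberTheory.DiophantineGeometry.TateAlgorithm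
  Literature.NumberTheory.DiophantineGeometry.TateAlgorithm.CharTwo Literature.NumberTheory.EllipticCurves

namespace Summit.BirchSwinnertonDyer.BirchSwinnertonDyer.Theorems.ManinLocalTwoThree

/-! ## §1 `2` a uniformiser: on the `f = 4` rows `Iₙ*/(n+8)`, `n ≥ 4`, `a₁/2` is a unit, `ord c₄ = 4`, `ord₂ j = 4 − n` -/

section TwoUniformiser

variable {R : Type*} [CommRing R] [IsDomain R] [IsDiscreteValuationRing R]

/-- **On the Step-7 form of a curve of type `Iₙ*` (`n ≥ 2`) with `ord Δ = n + 8`, `a₁/2` is a unit** (`2` a uniformiser, perfect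
residue field; stated for `Istar (n + 2)`, `ord Δ = n + 10`): otherwise `4 ∣ a₁` and §2 gives `ord Δ ≥ n + 9`.  These are the `v(a₁) = 1` rows
of Barrios et al.'s Table (the `f = 4` rows `I₄*/12`, `Iₙ≥5*/(n+8)`; also `I₂*/10`, `I₃*/11`).
[cite: SilvermanATAEC1994, IV.9.4 Step 7] [cite: BarriosEtAl2025, Thm. 5.1, Table localdata-dodd, rows I*ₙ with v(a₁) = 1 (arXiv p. 16)] -/
theorem isUnit_of_a₁_eq_two_mul_of_kodairaSymbolOfMinimal_eq_Istar_succ_succ [PerfectField (ResidueField R)]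
    (h2 : Irreducible (2 : R)) (N : WeierstrassCurve R) (hΔ0 : N.Δ ≠ 0) {α : R} (h₁ : N.a₁ = 2 * α)
    (h₂ : N.a₂ ∈ maximalIdeal R) (h3 : N.a₃ ∈ maximalIdeal R ^ 2) (h4 : N.a₄ ∈ maximalIdeal R ^ 2) (h6 : N.a₆ ∈ maximalIdeal R ^ 3)
    {n : ℕ} (hN : N.kodairaSymbolOfMinimal = .Istar (n + 2)) (hord : (addVal R N.Δ).toNat = n + 10) : IsUnit α := by
  by_contra hα
  have h2m : (2 : R) ∈ maximalIdeal R := (IsLocalRing.mem_maximalIdeal _).mpr h2.not_isUnit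
  have hαm : α ∈ maximalIdeal R := (IsLocalRing.mem_maximalIdeal _).mpr hα
  have h1 : N.a₁ ∈ maximalIdeal R ^ 2 := by rw [h₁, pow_two]; exact Ideal.mul_mem_mul h2m hαm
  have := le_addVal_Δ_toNat_of_kodairaSymbolOfMinimal_eq_Istar_succ_succ_of_a₁_mem_sq h2m N hΔ0 h1 h₂ h3 h4 h6 hN
  omega

omit [IsDomain R] [IsDiscreteValuationRing R] in
/-- `c₄` of a model `[2α, 2β, 4γ, 8q, a₆]`: `c₄ = b₂² − 24b₄ = 16·(α⁴ + 2(2α²β + 2β² − 12q − 6αγ))`. [folklore] -/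
theorem c₄_of_istarSevenForm (N : WeierstrassCurve R) {α β γ q : R} (h₁ : N.a₁ = 2 * α) (h₂ : N.a₂ = 2 * β)
    (h₃ : N.a₃ = 4 * γ) (h₄ : N.a₄ = 8 * q) :
    N.c₄ = 2 ^ 4 * (α ^ 4 + 2 * (2 * α ^ 2 * β + 2 * β ^ 2 - 12 * q - 6 * α * γ)) := by
  simp only [WeierstrassCurve.c₄, WeierstrassCurve.b₂, WeierstrassCurve.b₄, h₁, h₂, h₃, h₄]
  ring

/-- **`ord c₄ = 4` on the Step-7 form `[2α, 2β, 4γ, 8q, 16r]` when `α` is a unit** (`2` a uniformiser).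
[cite: SilvermanATAEC1994, IV.9.4 Step 7 and Table 4.1] -/
theorem addVal_c₄_of_istarSevenForm_of_isUnit (h2 : Irreducible (2 : R)) (N : WeierstrassCurve R) {α β γ q : R}
    (h₁ : N.a₁ = 2 * α) (h₂ : N.a₂ = 2 * β) (h₃ : N.a₃ = 4 * γ) (h₄ : N.a₄ = 8 * q) (hα : IsUnit α) :
    addVal R N.c₄ = 4 := by
  have hU : IsUnit (α ^ 4 + 2 * (2 * α ^ 2 * β + 2 * β ^ 2 - 12 * q - 6 * α * γ)) :=
    isUnit_add_mul_of_isUnit h2 (hα.pow 4) _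
  obtain ⟨u, hu⟩ := hU
  rw [c₄_of_istarSevenForm N h₁ h₂ h₃ h₄, addVal_mul, addVal_pow, addVal_uniformizer h2, ← hu, addVal_eq_zero_of_unit]
  simp

end TwoUniformiser

/-! ## §2 Over a Dedekind domain at an absolutely unramified `2`-adic place: `Iₙ*/(n+8)`, `n ≥ 4` has `|j|_v = exp(n − 4) ≥ 1` -/

section Dedekind

open IsDedekindDomain

variable {A : Type*} [CommRing A] [IsDedekindDomain A] {K : Type*} [Field K] [Algebra A K] [IsFractionRing A K]
  (v : HeightOneSpectrum A) (W : WeierstrassCurve K)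

/-- **`|j|_v = exp(n − 2)` for Kodaira type `Istar (n + 2)` with `ord_v Δ_min = n + 10`** at an absolutely unramified `2`-adic place
(`2` a uniformiser of `O_v`, perfect residue field): on the Step-7 form `N = [2α, 2β, 4γ, 8q, 16r]` of the local minimal model `α` is a
unit (§1), so `ord_v c₄(N) = 4` and `ord_v j = 12 − (n + 10) = 2 − n`, i.e. `|j|_v = exp(n − 2)`; `j` is read on `N ⊗ K_v ≅ W ⊗ K_v`.
For the `f_v = 4` rows `I₄*/12` (`n = 2`) and `I*_{m+5}/(m+13)` (`n = m + 3`) this is `|j|_v ≥ 1`, i.e. `ord_v j ≤ 0`.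
[cite: SilvermanATAEC1994, IV.9.4 Step 7, Table 4.1] [cite: BarriosEtAl2025, Thm. 5.1, Table localdata-dodd, rows I*ₙ (arXiv:2501.03209 p. 16)] -/
theorem valuation_j_eq_exp_of_kodairaSymbolAt_eq_Istar_succ_succ_of_irreducible_two [W.IsElliptic]
    [PerfectField (IsLocalRing.ResidueField (v.adicCompletionIntegers K))]
    (h2 : Irreducible (2 : v.adicCompletionIntegers K)) {n : ℕ} (hT : W.kodairaSymbolAt v = .Istar (n + 2))
    (hord : W.ordMinimalDiscriminant v = n + 10) :
    v.valuation K W.j = WithZero.exp ((n : ℤ) - 2) := by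
  set O := v.adicCompletionIntegers K with hO
  set Kv := v.adicCompletion K with hKv
  set V : WeierstrassCurve O := W.localMinimalIntegralModel v with hV
  have hm : ∀ {x : O}, x ∈ maximalIdeal O ↔ (2 : O) ∣ x := fun {x} ↦ mem_maximalIdeal_iff_dvd_of_irreducible h2 x
  have hmn : ∀ {x : O} {k : ℕ}, x ∈ maximalIdeal O ^ k ↔ (2 : O) ^ k ∣ x := fun {x k} ↦
    mem_maximalIdeal_pow_iff_dvd_of_irreducible h2 x k
  have hTV : V.kodairaSymbolOfMinimal = .Istar (n + 2) := by rw [← WeierstrassCurve.kodairaSymbolAt_def]; exact hT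
  have hΔV : V.Δ ≠ 0 := W.localMinimalIntegralModel_Δ_ne_zero v
  have hordV : (addVal O V.Δ).toNat = n + 10 := by rw [← hord]; rfl
  -- the Step-7 form `N = D • V`
  obtain ⟨D, h1m, h2m, -, h3m, h4m, h6m⟩ := exists_smul_of_kodairaSymbolOfMinimal_eq_Istar_succ V hTV
  set N : WeierstrassCurve O := D • V with hN
  obtain ⟨α, hα⟩ := hm.mp h1m
  obtain ⟨β, hβ⟩ := hm.mp h2m
  obtain ⟨γ, hγ⟩ := hmn.mp h3m
  obtain ⟨q, hq⟩ := hmn.mp h4m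
  have hTN : N.kodairaSymbolOfMinimal = .Istar (n + 2) := by rw [hN, WeierstrassCurve.kodairaSymbolOfMinimal_smul]; exact hTV
  have hΔN : N.Δ ≠ 0 := by
    rw [hN, WeierstrassCurve.variableChange_Δ]; exact mul_ne_zero (pow_ne_zero 12 (Units.ne_zero _)) hΔV
  have hordN : (addVal O N.Δ).toNat = n + 10 := by rw [hN, addVal_Δ_smul_toNat]; exact hordV
  have hαu : IsUnit α :=
    isUnit_of_a₁_eq_two_mul_of_kodairaSymbolOfMinimal_eq_Istar_succ_succ h2 N hΔN hα h2m h3m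
      (Ideal.pow_le_pow_right (by norm_num) h4m) (Ideal.pow_le_pow_right (by norm_num) h6m) hTN hordN
  have hc₄ : addVal O N.c₄ = 4 :=
    addVal_c₄_of_istarSevenForm_of_isUnit h2 N hα hβ (by rw [hγ]; ring) (by rw [hq]; ring) hαu
  -- valuations in `K_v`
  have hc₄0 : N.c₄ ≠ 0 := by
    intro h0; rw [h0, addVal_zero] at hc₄; exact absurd hc₄ (by decide)
  obtain ⟨k₄, hk₄, hvc₄⟩ := HeightOneSpectrum.exists_addVal_adicCompletionIntegers_eq K v N.c₄ hc₄0
  have hk₄' : k₄ = 4 := by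
    have : ((k₄ : ℕ∞)) = 4 := by rw [← hk₄, hc₄]
    exact_mod_cast this
  obtain ⟨kΔ, hkΔ, hvΔ⟩ := HeightOneSpectrum.exists_addVal_adicCompletionIntegers_eq K v N.Δ hΔN
  have hkΔ' : kΔ = n + 10 := by
    rw [← hordN, hkΔ]; rfl
  -- `j` read on `N ⊗ K_v = Ctot • (W ⊗ K_v)`
  obtain ⟨C, hC⟩ := W.exists_localMinimalIntegralModel_baseChange_eq v
  set X : WeierstrassCurve Kv := W.baseChange Kv with hX
  set Ctot : WeierstrassCurve.VariableChange Kv := D.map (algebraMap O Kv) * C with hCtot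
  have hNX : Ctot • X = N.baseChange Kv := by
    rw [hCtot, mul_smul, ← hC, hN, WeierstrassCurve.baseChange, WeierstrassCurve.baseChange, WeierstrassCurve.map_variableChange]
  have hjX : X.j = algebraMap K Kv W.j := WeierstrassCurve.map_j W (algebraMap K Kv)
  have hjC : (Ctot • X).j = X.j := WeierstrassCurve.variableChange_j X Ctot
  have hc₄X : (Ctot • X).c₄ = ((N.c₄ : O) : Kv) := by
    rw [hNX, WeierstrassCurve.baseChange, WeierstrassCurve.map_c₄]; rfl
  have hΔX : (Ctot • X).Δ = ((N.Δ : O) : Kv) := by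
    rw [hNX, WeierstrassCurve.baseChange, WeierstrassCurve.map_Δ]; rfl
  have hj : (Ctot • X).j = (((N.Δ : O) : Kv))⁻¹ * ((N.c₄ : O) : Kv) ^ 3 := by
    rw [WeierstrassCurve.j, Units.val_inv_eq_inv_val, WeierstrassCurve.coe_Δ', hΔX, hc₄X]
  have hval : v.valuation K W.j = Valued.v (algebraMap K Kv W.j) :=
    (HeightOneSpectrum.valuedAdicCompletion_eq_valuation' v W.j).symm
  rw [hval, ← hjX, ← hjC, hj, map_mul, map_inv₀, map_pow, hvc₄, hvΔ, hk₄', hkΔ']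
  rw [← WithZero.exp_nsmul, ← WithZero.exp_neg, ← WithZero.exp_add]
  congr 1
  push_cast
  ring

/-- **The `f_v = 4` rows `Iₙ*/(n+8)`, `n ≥ 4`, have `ord_v j ≤ 0`** (`1 ≤ |j|_v`): stated for `Istar (n + 4)` with `ord_v Δ_min = n + 12`
(`n = 0`: `I₄*/12`, the twists of good ordinary curves, `|j|_v = 1`; `n ≥ 1`: `I*_{n+4}/(n+12)`, potentially multiplicative, `|j|_v = 2^n`).
[cite: BarriosEtAl2025, Thm. 5.1, Table localdata-dodd, rows I₀ (v(a₁) = 0) / I_{n>0} with d ≡ 3 (mod 4) (arXiv:2501.03209 pp. 15–16)] -/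
theorem one_le_valuation_j_of_kodairaSymbolAt_eq_Istar_add_four_of_irreducible_two [W.IsElliptic]
    [PerfectField (IsLocalRing.ResidueField (v.adicCompletionIntegers K))]
    (h2 : Irreducible (2 : v.adicCompletionIntegers K)) {n : ℕ} (hT : W.kodairaSymbolAt v = .Istar (n + 4))
    (hord : W.ordMinimalDiscriminant v = n + 12) : 1 ≤ v.valuation K W.j := by
  rw [valuation_j_eq_exp_of_kodairaSymbolAt_eq_Istar_succ_succ_of_irreducible_two v W h2 (n := n + 2) hT (by omega),
    ← WithZero.exp_zero, WithZero.exp_le_exp]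
  push_cast
  omega

end Dedekind

end Summit.BirchSwinnertonDyer.BirchSwinnertonDyer.Theorems.ManinLocalTwoThree

end
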